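import Summits.NavierStokesRegularity.NavierStokesRegularity.Theorems.ScenarioCensusRowF1EchoTop
import HarnessLib

/-!
# LINE 39 «echo-top» port, part 2/3: §4 THE ECHO KILLS — (KT) time-translation rigidity of `𝒦_M`, (KE) one echoing slice ⇒ trivial, the point echo; the profile predicates
# `EchoDefectBelow` / `PointEchoDefectBelow` and the levels `exists_echoLevel` / `exists_pointEchoLevel` (LINE 36's `pocket_limit` BY NAME)

Re-homed for the scenario census (typer seat ns-census-typer-1 g10; the cells F1ep / F1ew and the floors EF / PEF are MEMBERS OF RECORD «DECIDED IN KERNEL IN FILES» of row F1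
(item 82: critic idea-crit-3 g10 PASS 11:46:18Z; ref ns-census-ref g14 PRE-CHECK ✓ §19.6; lead label); this port makes them TREE-decided): VERBATIM PORT of ns-idea-3 LINE 39
«echo-top», `pub/ideators/ns-idea-3/lines/echo-top/line-echo-top.lean` sha16 2e8e6517bab89429 (1057 l., lean check rc 0, 0 sorry), split for the 400-line rule into
`ScenarioCensusRowF1EchoTop` (§1–§3) → `…EchoTopKill` (§4) → `…EchoTopRows` (§5–§7 + census KEYS).  Lean text VERBATIM in namespace `…Theorems.ScenarioCensus.EchoTop` (the
line's `…Cruxes.ScenarioCensusRowF1.EchoTopLine` re-homed); port edits: the frame restated VERBATIM by the line from LINES 34–38 (`topSet`, `HasTypeIConstant`, `snapLevel`,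
`exists_fast_at`, `sqrt_mul_sq_mul`, `pocket_limit`, `limitClass_compact`, `exists_level_of_limitKill`, `zoom_units`) is taken BY NAME from the landed two-time-top / one-level-top /
snapshot-top / needle-top ports; `@[conjecture]` on the residual `EchoCollapse` (≡ `ScenarioCensus.Row_F1`, OPEN); one-line docstrings added where missing (gate lint).  Statements
untouched.

No census VALUE is moved here (row F1 stays OPEN-WITH-LINE; the members become TREE-decided by name); NS regularity is NOT proved; `Row_F1` is untouched (zero
movement, `echoCollapse_iff_rowF1`); no summit statement is proved by this file. Lemmas that restate already-landed tree declarations are taken BY NAME (gate lint `dedup.landed`): `topSet` = `TwoTimeTop.topSet`, `HasTypeIConstant` = `OneLevelTop.HasTypeIConstant`, `snapLevel` = `SnapshotTop.snapLevel`, `exists_fast_at` = `SnapshotTop.exists_fast_at`, `sqrt_mul_sq_mul` = `SnapshotTop.sqrt_mul_sq_mul`, `pocket_limit` = `SnapshotTop.pocket_limit`, `limitClass_compact` = `NeedleTop.limitClass_compact`, `exists_level_of_limitKill` = `NeedleTop.exists_level_of_limitKill`, `zoom_units` = `NeedleTop.zoom_units`.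
-/

-- the summit and its single problem share the name `NavierStokesRegularity` (D-0017 nested layout)
set_option linter.dupNamespace false

noncomputable section

open MeasureTheory Set Function Filter TopologicalSpace Metric
open scoped Topology NNReal ENNReal InnerProductSpace

namespace Summit.NavierStokesRegularity.NavierStokesRegularity.Theorems.ScenarioCensus.EchoTop

open Literature.Analysis Literature.Analysis.FluidPDE
open Summit.NavierStokesRegularity.NavierStokesRegularity.Theorems
open Summit.NavierStokesRegularity.NavierStokesRegularity.Theses
open Summit.NavierStokesRegularity.NavierStokesRegularity.Theorems.LocalHelicityTubeDoorFrobeniusProfileRigidityHelicalSlice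

/-! ## §4 MECHANISM, part 2 — THE ECHO KILLS: (KT) time-translation rigidity of `𝒦_M`, (KE) one echoing slice ⇒ trivial (the tree's
ONE-SLICE theorems), (KP) a point echo on a time window kills the point

The class `𝒦_M = IsTypeIAncientMild M` is invariant under time shifts into the past and under spatial translations (tree
`IsTypeIAncientMild.comp_sub_right`, `.comp_add_right`, KNSS 2009 §1), and every member DECAYS at `−∞`: `‖W(s, y)‖ ≤ M/√(−s)`.  Hence:

* (KT) if the WHOLE flow echoes, `W(s, y) = W(s − θ, y + d)` for all `s < 0`, `y`, with `θ > 0`, then iterating `W(s, y) = W(s − nθ, y + nd)`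
  and the envelope give `W ≡ 0` (`eq_zero_of_echo_everywhere`) — the discrete time-translation (and travelling-wave) members of `𝒦_M` are
  trivial.  CONTRAST: DISCRETE SELF-SIMILARITY `W(s, y) = λW(λ²s, λy)` is the OPEN scenario of the table — the decay at `−∞` is exactly
  balanced by the rescaling; an echo WITHOUT rescaling is not.
* (KE) ONE echoing slice suffices (`eq_zero_of_echo_slice`): for `θ > 0` the shifted field `V(s, y) = W(s − θ, y + d)` is in `𝒦_M` and
  agrees with `W` on the slice `s₀`, so by the tree's ONE SLICE DETERMINES THE PROFILE (`eq_of_slice_eq`, door S11: forward bounded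
  Oseen-mild uniqueness `oseenMild_bounded_unique`, backward real-analyticity in time) `W = V` on every slice and (KT) applies; for
  `θ = 0`, `d ≠ 0` the slice is `d`-PERIODIC and the tree's `eq_zero_of_periodic_slice` (every slice periodic, then the zoom-OUT theorem
  `eq_zero_of_spatiallyPeriodic`, seat K2-p2) concludes.  An echo on a BALL of one slice is an echo of the slice (`echo_slice_of_ball`,
  real-analytic slices, tree `IsTypeIAncientMild.analyticOnNhd_slice_univ`).
* (KP) a POINT echo `W(s, y₀) = W(s − θ, y₀)` for `s` in an interval (`eq_zero_of_pointEcho`): the time signal at `y₀` is real-analytic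
  on `(−∞, 0)` (tree `IsTypeIAncientMild.analyticAt_time`, Lemarié-Rieusset 2016 Thm 9.12), so it is `θ`-periodic on the whole past, and
  the envelope kills it: `W(·, y₀) ≡ 0`.  No spatial structure is used at all. -/

/-- **Far in the past every member of `𝒦_M` is uniformly small**: for `κ > 0` and a step `θ > 0` there is `n` with `t − nθ < 0` and
`‖W(s, y)‖ < κ` for all `s ≤ t − nθ` and all `y` (the envelope `M/√(−s)`). -/
theorem exists_norm_lt_of_le {M : ℝ} {W : ℝ → E3 → E3} (hW : IsTypeIAncientMild M W) {θ : ℝ} (hθ : 0 < θ) (t : ℝ)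
    {κ : ℝ} (hκ : 0 < κ) : ∃ n : ℕ, t - n * θ < 0 ∧ ∀ s ≤ t - n * θ, ∀ y : E3, ‖W s y‖ < κ := by
  obtain ⟨n, hn⟩ := exists_nat_gt (((M / κ) ^ 2 + |t|) / θ)
  have hnθ : (M / κ) ^ 2 + |t| < n * θ := by rwa [div_lt_iff₀ hθ] at hn
  have ht : t ≤ |t| := le_abs_self t
  have hsq : 0 ≤ (M / κ) ^ 2 := sq_nonneg _
  refine ⟨n, by linarith, fun s hs y => ?_⟩
  have hs0 : s < 0 := by linarith
  have hlt : (M / κ) ^ 2 < -s := by linarith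
  have hpos : 0 < Real.sqrt (-s) := Real.sqrt_pos.2 (by linarith)
  have hsqrt : M / κ < Real.sqrt (-s) := by
    calc M / κ ≤ |M / κ| := le_abs_self _
      _ = Real.sqrt ((M / κ) ^ 2) := (Real.sqrt_sq_eq_abs _).symm
      _ < Real.sqrt (-s) := Real.sqrt_lt_sqrt hsq hlt
  have hMlt : M < Real.sqrt (-s) * κ := (div_lt_iff₀ hκ).1 hsqrt
  have h2 : M / Real.sqrt (-s) < κ := by
    rw [div_lt_iff₀ hpos]
    linarith [mul_comm (Real.sqrt (-s)) κ]
  exact (hW.norm_le hs0 y).trans_lt h2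

/-- **(KT) TIME-TRANSLATION RIGIDITY OF `𝒦_M`: a flow that echoes everywhere is trivial.**  If `W ∈ 𝒦_M`, `θ > 0`, and
`W(s, y) = W(s − θ, y + d)` for all `s < 0` and all `y`, then `W ≡ 0` on the open past. -/
theorem eq_zero_of_echo_everywhere {M θ : ℝ} {d : E3} {W : ℝ → E3 → E3} (hW : IsTypeIAncientMild M W) (hθ : 0 < θ)
    (h : ∀ s < 0, ∀ y : E3, W s y = W (s - θ) (y + d)) : ∀ s < 0, ∀ y : E3, W s y = 0 := by
  have hiter : ∀ n : ℕ, ∀ s < 0, ∀ y : E3, W s y = W (s - n * θ) (y + (n : ℝ) • d) := by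
    intro n
    induction n with
    | zero => intro s hs y; simp
    | succ n ih =>
      intro s hs y
      have hn : (0 : ℝ) ≤ n * θ := by positivity
      rw [ih s hs y, h (s - n * θ) (by linarith) (y + (n : ℝ) • d)]
      have e1 : s - (n : ℝ) * θ - θ = s - ((n + 1 : ℕ) : ℝ) * θ := by push_cast; ring
      have e2 : y + (n : ℝ) • d + d = y + ((n + 1 : ℕ) : ℝ) • d := by
        rw [Nat.cast_succ, add_smul, one_smul, add_assoc]
      rw [e1, e2]
  intro s hs y
  by_contra hne
  obtain ⟨n, -, hfar⟩ := exists_norm_lt_of_le hW hθ s (norm_pos_iff.2 hne)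
  have hlt := hfar (s - n * θ) le_rfl (y + (n : ℝ) • d)
  rw [← hiter n s hs y] at hlt
  exact lt_irrefl _ hlt

/-- Sub-slab boundedness of a member of `𝒦_M` (the form in which the tree's one-slice theorems take their hypotheses). -/
theorem bdd_of_mem {M : ℝ} {W : ℝ → E3 → E3} (hW : IsTypeIAncientMild M W) :
    ∀ δ : ℝ, 0 < δ → ∃ B : ℝ, ∀ t < -δ, ∀ y : E3, ‖W t y‖ ≤ B := by
  intro δ hδ
  refine ⟨M / Real.sqrt δ, fun t ht y => (hW.norm_le (by linarith) y).trans ?_⟩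
  exact div_le_div_of_nonneg_left hW.nonneg (Real.sqrt_pos.2 hδ) (Real.sqrt_le_sqrt (by linarith))

/-- The shifted field `(s, y) ↦ W(s − θ, y + d)` of a member of `𝒦_M` is a member of `𝒦_M` (`θ ≥ 0`; tree `comp_add_right`,
`comp_sub_right`). -/
theorem shift_mem {M θ : ℝ} {d : E3} {W : ℝ → E3 → E3} (hW : IsTypeIAncientMild M W) (hθ : 0 ≤ θ) :
    IsTypeIAncientMild M (fun s y => W (s - θ) (y + d)) :=
  (hW.comp_add_right d).comp_sub_right hθ

/-- **(KE) ONE ECHOING SLICE ⇒ TRIVIAL.**  `W ∈ 𝒦_M`, `θ ≥ 0`, `(θ, d) ≠ (0, 0)`, and ONE slice `s₀ < 0` echoes: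
`W(s₀, y) = W(s₀ − θ, y + d)` for every `y`.  Then `W ≡ 0` on the open past.  (`θ = 0`: the tree's one-periodic-slice theorem
`eq_zero_of_periodic_slice`; `θ > 0`: the tree's `eq_of_slice_eq` applied to `W` and its shift, then (KT).) -/
theorem eq_zero_of_echo_slice {M θ : ℝ} {d : E3} {W : ℝ → E3 → E3} (hW : IsTypeIAncientMild M W) (hθ : 0 ≤ θ)
    (hnd : 0 < θ ∨ d ≠ 0) {s₀ : ℝ} (hs₀ : s₀ < 0) (hecho : ∀ y : E3, W s₀ y = W (s₀ - θ) (y + d)) :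
    ∀ s < 0, ∀ y : E3, W s y = 0 := by
  rcases hθ.eq_or_lt with h0 | hθpos
  · -- `θ = 0`: a `d`-periodic slice, `d ≠ 0`
    have hd : d ≠ 0 := by
      rcases hnd with h | h
      · exact absurd h (by rw [← h0]; exact lt_irrefl 0)
      · exact h
    have hper : ∀ y : E3, W s₀ (y + d) = W s₀ y := by
      intro y
      have := hecho y
      rw [← h0, sub_zero] at this
      exact this.symm
    exact eq_zero_of_periodic_slice hW.hasTypeITimeDecay hW.continuousOn_uncurry
      (fun s t hst ht x => hW.mild_eq_heatExtension hst ht x) (fun t ht => hW.isDivFree ht) hs₀ hd hper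
  · -- `θ > 0`: the shifted field is in the class and agrees with `W` on the slice `s₀`
    have hVK : IsTypeIAncientMild M (fun s y => W (s - θ) (y + d)) := shift_mem hW hθ
    have heq : ∀ t < 0, W t = (fun s y => W (s - θ) (y + d)) t :=
      eq_of_slice_eq hW.continuousOn_uncurry (bdd_of_mem hW) (fun s t hst ht x => hW.mild_eq_heatExtension hst ht x)
        hVK.continuousOn_uncurry (bdd_of_mem hVK) (fun s t hst ht x => hVK.mild_eq_heatExtension hst ht x)
        hs₀ (funext hecho)
    exact eq_zero_of_echo_everywhere hW hθpos (fun s hs y => congrFun (heq s hs) y)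

/-- **An echo on a BALL of one slice is an echo of the whole slice** (real-analytic slices, identity theorem on the connected `ℝ³`). -/
theorem echo_slice_of_ball {M θ : ℝ} {d : E3} {W : ℝ → E3 → E3} (hW : IsTypeIAncientMild M W) (hθ : 0 ≤ θ)
    {s₀ : ℝ} (hs₀ : s₀ < 0) {z : E3} {r : ℝ} (hr : 0 < r) (h : ∀ y ∈ ball z r, W s₀ y = W (s₀ - θ) (y + d)) :
    ∀ y : E3, W s₀ y = W (s₀ - θ) (y + d) := by
  have h1 : AnalyticOnNhd ℝ (W s₀) univ := hW.analyticOnNhd_slice_univ hs₀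
  have h2 : AnalyticOnNhd ℝ ((fun s y => W (s - θ) (y + d)) s₀) univ := (shift_mem hW hθ).analyticOnNhd_slice_univ hs₀
  have hev : W s₀ =ᶠ[𝓝 z] (fun s y => W (s - θ) (y + d)) s₀ := by
    filter_upwards [isOpen_ball.mem_nhds (mem_ball_self hr)] with y hy
    exact h y hy
  have heq := h1.eqOn_of_preconnected_of_eventuallyEq h2 isPreconnected_univ (mem_univ z) hev
  exact fun y => heq (mem_univ y)

/-- **(KP) A POINT ECHO ON A TIME WINDOW KILLS THE POINT.**  `W ∈ 𝒦_M`, `θ > 0`, a point `y₀`, and `W(s, y₀) = W(s − θ, y₀)` for all `s`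
in a non-empty open interval of non-positive times.  Then `W(s, y₀) = 0` for every `s < 0`. -/
theorem eq_zero_of_pointEcho {M θ : ℝ} {W : ℝ → E3 → E3} (hW : IsTypeIAncientMild M W) (hθ : 0 < θ) (y₀ : E3)
    {s₁ s₂ : ℝ} (hs : s₁ < s₂) (hs₂ : s₂ ≤ 0) (hecho : ∀ s ∈ Ioo s₁ s₂, W s y₀ = W (s - θ) y₀) :
    ∀ s < 0, W s y₀ = 0 := by
  -- analytic continuation in time of the echo relation to the whole past
  have hg : AnalyticOnNhd ℝ (fun σ : ℝ => W σ y₀ - W (σ - θ) y₀) (Iio 0) := by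
    intro σ hσ
    have hσ0 : σ < 0 := hσ
    have h1 : AnalyticAt ℝ (fun σ : ℝ => W σ y₀) σ := hW.analyticAt_time hσ0 y₀
    have h2 : AnalyticAt ℝ (fun σ : ℝ => W σ y₀) (σ - θ) := hW.analyticAt_time (by linarith) y₀
    have h3 : AnalyticAt ℝ (fun σ : ℝ => σ - θ) σ := analyticAt_id.sub analyticAt_const
    exact h1.sub (AnalyticAt.comp (g := fun σ : ℝ => W σ y₀) (f := fun σ : ℝ => σ - θ) (x := σ) h2 h3)
  have hmid : (s₁ + s₂) / 2 ∈ Iio (0 : ℝ) := by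
    simp only [mem_Iio]
    linarith
  have hev : (fun σ : ℝ => W σ y₀ - W (σ - θ) y₀) =ᶠ[𝓝 ((s₁ + s₂) / 2)] 0 := by
    filter_upwards [isOpen_Ioo.mem_nhds (show (s₁ + s₂) / 2 ∈ Ioo s₁ s₂ from ⟨by linarith, by linarith⟩)] with σ hσ
    simp only [Pi.zero_apply, sub_eq_zero]
    exact hecho σ hσ
  have hall : ∀ σ < 0, W σ y₀ = W (σ - θ) y₀ := by
    intro σ hσ
    have := hg.eqOn_zero_of_preconnected_of_eventuallyEq_zero isPreconnected_Iio hmid hev (mem_Iio.2 hσ)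
    simpa [sub_eq_zero] using this
  -- the signal at `y₀` is `θ`-periodic on the whole past; the envelope kills it
  have hiter : ∀ n : ℕ, ∀ σ < 0, W σ y₀ = W (σ - n * θ) y₀ := by
    intro n
    induction n with
    | zero => intro σ hσ; simp
    | succ n ih =>
      intro σ hσ
      have hn : (0 : ℝ) ≤ n * θ := by positivity
      rw [ih σ hσ, hall (σ - n * θ) (by linarith),
        show σ - (n : ℝ) * θ - θ = σ - ((n + 1 : ℕ) : ℝ) * θ by push_cast; ring]
  intro s hs0
  by_contra hne
  obtain ⟨n, -, hfar⟩ := exists_norm_lt_of_le hW hθ s (norm_pos_iff.2 hne)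
  have hlt := hfar (s - n * θ) le_rfl y₀
  rw [← hiter n s hs0] at hlt
  exact lt_irrefl _ hlt

-- `pocket_limit`: the line restates the tree's `SnapshotTop.pocket_limit`; taken BY NAME (gate lint dedup.landed).

/-- The **echo defect below `Λ`** of `W` at the slice pair `(−1, −1 − θ)` (drift `d`, reach `A`, radius `a/2`): some closed ball of radius
`a/2` centred in `closedBall 0 A` on which `‖W(−1, y) − W(−1 − θ, y + d)‖ ≤ Λ`. -/
def EchoDefectBelow (θ : ℝ) (d : E3) (A a Λ : ℝ) (W : ℝ → E3 → E3) : Prop :=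
  ∃ z ∈ closedBall (0 : E3) A, ∀ y ∈ closedBall z (a / 2), ‖W (-1) y - W (-1 - θ) (y + d)‖ ≤ Λ

/-- **THE ECHO LEVEL `Λ₁(M, θ, d, A, a, κ)`**: no `W ∈ 𝒦_M` with `‖W(−1, 0)‖ ≥ κ` has echo defect below `Λ₁` (socket + `SnapshotTop.pocket_limit` +
`echo_slice_of_ball` + (KE)). -/
theorem exists_echoLevel (M θ A a : ℝ) (d : E3) (hθ : 0 ≤ θ) (hnd : 0 < θ ∨ d ≠ 0) (ha : 0 < a) {κ : ℝ} (hκ : 0 < κ) :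
    ∃ Λ₁ : ℝ, 0 < Λ₁ ∧ ∀ W : ℝ → E3 → E3, IsTypeIAncientMild M W → κ ≤ ‖W (-1) 0‖ →
      ¬ EchoDefectBelow θ d A a Λ₁ W := by
  refine NeedleTop.exists_level_of_limitKill M hκ (EchoDefectBelow θ d A a) ?_
  intro Wn W ε hεpos hεlim hWn hW hP hpt _ _
  choose z hz hcalm using hP
  have ha2 : 0 < a / 2 := by positivity
  have h1θ : (-1 : ℝ) - θ < 0 := by linarith
  obtain ⟨ζ₀, -, hζ₀⟩ := SnapshotTop.pocket_limit (f := fun n y => Wn n (-1) y - Wn n (-1 - θ) (y + d))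
    (g := fun y => W (-1) y - W (-1 - θ) (y + d)) ha2 hz hεlim
    (fun y => (hpt (-1) (by norm_num) y).sub (hpt (-1 - θ) h1θ (y + d))) hcalm
  have hball : ∀ y ∈ ball ζ₀ (a / 2 / 2), W (-1) y = W (-1 - θ) (y + d) := by
    intro y hy
    have h0 : ‖W (-1) y - W (-1 - θ) (y + d)‖ ≤ 0 := hζ₀ y (mem_closedBall.2 (mem_ball.1 hy).le)
    exact sub_eq_zero.1 (norm_le_zero_iff.1 h0)
  have hall := echo_slice_of_ball hW hθ (show (-1 : ℝ) < 0 by norm_num) (by positivity) hball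
  exact eq_zero_of_echo_slice hW hθ hnd (show (-1 : ℝ) < 0 by norm_num) hall (-1) (by norm_num) 0

/-- The **point-echo defect below `Λ`** of `W` at the origin on the window `[−1 − δ, −1]` (lag `θ`). -/
def PointEchoDefectBelow (θ δ Λ : ℝ) (W : ℝ → E3 → E3) : Prop :=
  ∀ s ∈ Icc (-1 - δ) (-1 : ℝ), ‖W s 0 - W (s - θ) 0‖ ≤ Λ

/-- **THE POINT-ECHO LEVEL `Λ₁(M, θ, δ, κ)`** (socket + (KP); only POINTWISE convergence at fixed points is used). -/
theorem exists_pointEchoLevel (M θ δ : ℝ) (hθ : 0 < θ) (hδ : 0 < δ) {κ : ℝ} (hκ : 0 < κ) :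
    ∃ Λ₁ : ℝ, 0 < Λ₁ ∧ ∀ W : ℝ → E3 → E3, IsTypeIAncientMild M W → κ ≤ ‖W (-1) 0‖ →
      ¬ PointEchoDefectBelow θ δ Λ₁ W := by
  refine NeedleTop.exists_level_of_limitKill M hκ (PointEchoDefectBelow θ δ) ?_
  intro Wn W ε hεpos hεlim hWn hW hP hpt _ _
  have hzero : ∀ s ∈ Ioo (-1 - δ) (-1 : ℝ), W s 0 = W (s - θ) 0 := by
    intro s hs
    have hs0 : s < 0 := by linarith [hs.2]
    have h1 : Tendsto (fun n => ‖Wn n s 0 - Wn n (s - θ) 0‖) atTop (𝓝 ‖W s 0 - W (s - θ) 0‖) :=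
      ((hpt s hs0 0).sub (hpt (s - θ) (by linarith) 0)).norm
    have hle : ‖W s 0 - W (s - θ) 0‖ ≤ 0 :=
      le_of_tendsto_of_tendsto h1 hεlim (Eventually.of_forall fun n => hP n s (Ioo_subset_Icc_self hs))
    exact sub_eq_zero.1 (norm_le_zero_iff.1 hle)
  exact eq_zero_of_pointEcho hW hθ 0 (show (-1 : ℝ) - δ < -1 by linarith) (by norm_num) hzero (-1) (by norm_num)

end Summit.NavierStokesRegularity.NavierStokesRegularity.Theorems.ScenarioCensus.EchoTop

end
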